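import Summits.QuantumFields.YangMills.Theorems.BalabanUVNodesN15PerCubeGreenNodeObjects
import Summits.QuantumFields.YangMills.Theorems.BalabanUVNodesN15PerCubeGreenTwoGridNamedReg335HolderRate
import Summits.QuantumFields.YangMills.Theorems.BalabanUVNodesN15PerCubeGreenTwoGridEntryThreeNamedReg335HolderRate
import HarnessLib

/-!
# N15 = NE2, road (c) — PROGRAMME (PC), (PC-E-N): ★★★★ `T4EtaRate.NE2PlusOperator` BY NAME FOR THE NAMED SCALAR COVARIANT GREEN's FUNCTION FAMILY ON THE PRINTED PER-CUBE CLASS —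
# ENTRIES 0 AND 3 OF (3.42) CONSTRUCTED AND PROVED (n15-c∕392, n15-c∕396: THE inverses `(Δ_{R_U} + aQ′_TᵀQ′_T)⁻¹`, no gauge choice), ENTRIES 1–2 DISPLAYED, `M = L^m` LIVE
# (dag-n15-c g35, n15-c∕398)

Cell `pub-ymgap`, seat `pub-ymgap-dag-n15-c` (generation g35; R134 (a) seat, strategy s1 «first missing estimate»; HUMAN RULING D-0062; chair R424 venue).
`bears_on: R4∕N15 · K3⁸ SpineGivenEndpointR13SepCoPHV (stmt-QuantumFields-27366)`; filed `--kind proof --supports stmt-QuantumFields-27366 --as helper` — COUNT-NEUTRAL.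
FOUR theorems, 0 `def`, 0 `sorry`: `pcRateConst_mono` (real bookkeeping: the constant of n15-c∕392∕396 grows with the class constant), ★★★★ `ne2PlusOperator_pc₀₃`, the non-vacuity
`pcInstance_reg335_one` (the trivial configuration is in the class at every index — dag-n07-a `reg910Cube_one`) and the corollary ★★★ `ne2ZeroOperator_pc₀₃` (`T4EtaRate.ne2Zero_of_ne2Plus`).  Imports BY NAME n15-c∕397
`…PerCubeGreenNodeObjects` (the index `PcIdx`, the unitary per-cube-class carrier `pcBgF`, the straight-holonomy pairing, `pcInstance` (`M = L^m` LIVE), `pcOps`∕`pcFamily` with entries 0, 3 =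
the η-defects of THE named Green's functions), n15-c∕392 `…NamedReg335HolderRate` (★★★★ `uN_idef_scGreenOp_of_reg910_rate`: entry 0), n15-c∕396 `…EntryThreeNamedReg335HolderRate` (★★★★
`uN_idef_scGreenOp_entryThree_of_reg910_rate`: entry 3), and through n15-c∕397 dag-n15-c g16 FILE 132 (`sfGeo_len`, `sfGeo_rateFactor`, `sfGeo_dist_nonneg`, `hasMaj_unitTorusGeoS`) and n15-b
`OperatorReadout` (`etaRateIneq342_of_hasMaj`, `pref4_pos`).  Nothing in the tree is modified, no landed name re-declared.

THE THEOREM `ne2PlusOperator_pc₀₃`.  For odd `L ≥ 7`, `a₀ > 0` (King's mass window), `c₃₅ > 0` ((3.35)'s `O(1)`), `c₄r ≥ 0` (the ratio of [B11] (9)'s Hölder constant to the (3.35)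
constant), `β₀ > 0` (the Hölder exponent), trace-form-orthonormal coordinates `e` of `𝔲(m)` (`m ≥ 1`): IF the consumer's entry-1 and entry-2 operators `E i 1`, `E i 2` obey, for
`M₁ ≤ L^m`, `0 < α₀`, `L^m·α₀ ≤ a₁` and every `U′` in the class, the (3.42)-shaped block majorant `B₁·pref4(len)_n·e^{−δ₁d}·max(rf_{γ₁}(y), rf_{γ₁}(y′))` (uniform `M₁, δ₁, a₁, B₁, γ₁ > 0` —
DISPLAYED: the gradient entries' two-grid jet editions on the per-cube class are not in the tree), THEN
`T4EtaRate.NE2PlusOperator c₃₅ (pcInstance d mm ι c₄r β₀ hL) (fun i => pcFamily d mm ι a₀ e c₄r β₀ hL i (E i))` — whose ENTRY 0 is the two-grid η-defect through the covariant transport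
`τ_{Ad∘U′}` of THE fine scalar covariant Green's function `(Δ_{R_U′} + a′Q′_TᵀQ′_T)⁻¹` against THE coarse one at the straight holonomies, and whose ENTRY 3 is the same for
`Δ_{R_U}∘(Δ_{R_U} + aQ′_TᵀQ′_T)⁻¹`, BOTH PROVED with NO displayed row from ONE [B11] Thm 1 (9)–(10) datum per cube (n15-c∕392, n15-c∕396), uniformly in the fine spacing.
THE CONSTANTS: `a₀′ := min(a₁, min(c₀, c₀′)∕(2c₃₅S + 1))` with `S = (1 + κ_e·2√m·√m)²` (so that the class constant `C = c₃₅·L^m·α₀ ≤ c₃₅a₀′` meets BOTH smallness conditions at `ξ = 1`);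
`M₅ := max(w₀, w₀′, M₁, 1)`; `δ₀ := min(δ∕16, ρ₀, δ₁)`; `γ := min(1∕4, β₀, γ₁)` (`(L^k)^{−1∕4} + (2L^{−k})^{β₀} ≤ (1 + 2^{β₀})(L^k)^{−γ}`); `B₀ := (max D 0 + max D′ 0)·(1 + κ_e·m·R(c₃₅a₀′))·
(1 + 2^{β₀}) + B₁` (`pcRateConst_mono`: the constant of 392∕396 is monotone in `C`).  The guard `M₅ ≤ M = L^m` is LIVE (`pcInstance_gf_M`, unbounded).

HONEST FRAMING ∕ LIMITS.  Packaging + real bookkeeping over landed theorems; MODEL family: THE scalar covariant Green's function `G′(U)` of the (PC) chain (n15-b's covariant Laplacian species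
(3.50) at `Ad∘U` + Bałaban's covariant averaging summand `a·Q′_TᵀQ′_T`, King's doubled-torus cover, one cube scale `ξ = 1`, straight-holonomy pairing; the (3.35) constant tied to the
cover's size parameter `M = L^m`); the class is dag-n07-a's typed `Reg910Cube` ([B11] Thm 1 (9)–(10) per cube) as a HYPOTHESIS on the configuration (its production = nodes N04∕N07, NOT
claimed); entries 1–2 DISPLAYED.  This is the SHAPE of [B9] Thm 3.1∕3.14 for `G′`, NOT the printed theorems; nothing of [B9]∕[B11] asserted.  NE2⁺ NOT PRINTED ∕ NOT proved as printed; N15 of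
record untouched (DISCHARGED AS CONSUMED, p687738); K3⁸ OPEN; counts of record UNMOVED (typed 28∕28 · discharged 8∕27); one finite 𝕋⁴ at fixed ε per index — NOT infinite volume, NOT OS on
ℝ⁴, NOT a mass gap, NOT Clay.  Restate-immune (no Theses import).
-/

set_option autoImplicit false

noncomputable section

open scoped BigOperators Matrix Matrix.Norms.L2Operator

namespace Summit.QuantumFields.YangMills.BalabanUVNodes.N15.Gluing

open Literature.MathematicalPhysics.QuantumFieldTheory.Balaban1983to89
open Literature.MathematicalPhysics.QuantumFieldTheory.Balaban1983to89.B5Prop11Plancherel (Tor fine unitVec)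
open Literature.MathematicalPhysics.QuantumFieldTheory.Balaban1983to89.B11SectG (BlockNorm HasMaj)
open Literature.MathematicalPhysics.QuantumFieldTheory.Balaban1983to89.T4EtaRate (NE2PlusOperator EtaRateIneq342 rateFactor rateFactor_nonneg)
open Literature.MathematicalPhysics.QuantumFieldTheory.Balaban1983to89.T4EtaRateDefect (idef rateWeight)
open Literature.MathematicalPhysics.QuantumFieldTheory.Balaban1983to89.B6UnitTorusCarrier (unitTorusGeo)
open Literature.MathematicalPhysics.QuantumFieldTheory.King1986 (aK)
open Literature.MathematicalPhysics.QuantumFieldTheory.King1986.Torus (tdistT tdistT_nonneg)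
open Literature.Barriers.QuantumFields (traceForm)
open Summit.QuantumFields.YangMills.BalabanUVNodes.N15.VectorPiece (kingPr unitTorusGeoS rateWeight_unitTorusGeoS)
open Summit.QuantumFields.YangMills.BalabanUVNodes.N15.MatrixSpecies (coordMat liftBlk basisConst basisConst_nonneg)
open Summit.QuantumFields.YangMills.BalabanUVNodes.N15.CovAvg (mprod kingSec ctauS)
open Summit.QuantumFields.YangMills.BalabanUVNodes.N15.OperatorReadout (opGeo opFamily opGeo_len rateFactor_opGeo etaRateIneq342_of_hasMaj pref4_pos)

variable {d : ℕ} {L : ℕ} [NeZero L]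

/-! ## §1 Real bookkeeping: the constant of n15-c∕392∕396 is monotone in the class constant -/

/-- The constant `R(C) = 4(c₄r·C)·1^{−(2+β₀)}e^{5C} + (2(d+1)+2)C⁴e^{2C} + 8C²e^{2C} + 8C²e^{5C}` of n15-c∕392∕396 at `ξ = 1`, `C₄ = c₄r·C` grows with `C ≥ 0`. [folklore] -/
theorem pcRateConst_mono {dd β₀ c₄r C C' : ℝ} (hdd : 0 ≤ dd) (hc₄ : 0 ≤ c₄r) (hC : 0 ≤ C) (hCC : C ≤ C') :
    (4 * (c₄r * C) * ((1 : ℝ) ^ (2 + β₀))⁻¹ * Real.exp (5 * (C / 1))) + ((2 * dd + 2) * ((C / 1 ^ 2) ^ 2 * Real.exp (2 * (C / 1))) + 8 * ((C / 1) * (C / 1 ^ 2) * Real.exp (2 * (C / 1))) +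
        8 * ((C / 1) * (C / 1 ^ 2) * Real.exp (5 * (C / 1)))) ≤
      (4 * (c₄r * C') * ((1 : ℝ) ^ (2 + β₀))⁻¹ * Real.exp (5 * (C' / 1))) + ((2 * dd + 2) * ((C' / 1 ^ 2) ^ 2 * Real.exp (2 * (C' / 1))) + 8 * ((C' / 1) * (C' / 1 ^ 2) * Real.exp (2 * (C' / 1))) +
        8 * ((C' / 1) * (C' / 1 ^ 2) * Real.exp (5 * (C' / 1)))) := by
  have h1 : (0 : ℝ) < ((1 : ℝ) ^ (2 + β₀))⁻¹ := by rw [Real.one_rpow, inv_one]; exact one_pos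
  have hC' : 0 ≤ C' := hC.trans hCC
  simp only [div_one, one_pow]
  gcongr

/-! ## §2 `NE2PlusOperator` by name: entries 0 and 3 constructed, entries 1–2 displayed -/

section Node

variable (d) (mm ι : Type) [Fintype mm] [DecidableEq mm] [Nonempty mm] [Fintype ι] [DecidableEq ι] (e : Matrix mm mm ℂ ≃L[ℝ] (ι → ℝ))

set_option maxHeartbeats 1600000 in
/-- ★★★★ **NE2⁺, OPERATOR LAYER, BY NAME, FOR THE NAMED SCALAR COVARIANT GREEN's FUNCTION FAMILY ON THE PRINTED PER-CUBE CLASS — ENTRIES 0 AND 3 CONSTRUCTED AND PROVED, ENTRIES 1–2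
DISPLAYED, `M = L^m` LIVE.**  See the module docstring for the reading, the constants and the limits.  MODEL family; NOT [B9] Thm 3.1∕3.14 as printed.
[cite: Balaban1985BackgroundPropagators, Thm 3.1 p.397 (quantifier template «M ≥ M₁ … Mα₀ ≤ a₀», (3.42) entries 0–3), Thm 3.14 pp.426–427 (difference template), (3.24)–(3.25) p.394, (3.35)–(3.36) p.396;
Balaban1985Variational, Thm 1 (9)–(10) p.279; King1986, Prop. 3.9 (3.73) p.665 (rate factor), Lemma 4.5 (4.38) p.674 (A = 0 template)] -/
theorem ne2PlusOperator_pc₀₃ (hL : Odd L ∧ 1 < L) (hL7 : 7 ≤ L) {a₀ : ℝ} (ha₀ : 0 < a₀) {c35 : ℝ} (hc35 : 0 < c35) {c₄r : ℝ} (hc₄r : 0 ≤ c₄r) {β₀ : ℝ} (hβ₀ : 0 < β₀)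
    (he : ∀ A B : Matrix mm mm ℂ, traceForm A B = e A ⬝ᵥ e B)
    (E : ∀ i : PcIdx d L, Fin 4 → (Fin (d + 1) → ScX' d L i.mv i.kk i.r hL → (Matrix mm mm ℂ)ˣ) → ((ScX d L i.mv i.kk hL × ι → ℝ) →ₗ[ℝ] (ScX' d L i.mv i.kk i.r hL × ι → ℝ)))
    (hE : ∃ M₁ δ₁ a₁ B₁ γ₁ : ℝ, 0 < M₁ ∧ 0 < δ₁ ∧ 0 < a₁ ∧ 0 < B₁ ∧ 0 < γ₁ ∧
      ∀ i : PcIdx d L, M₁ ≤ (L : ℝ) ^ i.mv → ∀ α₀ : ℝ, 0 < α₀ → (L : ℝ) ^ i.mv * α₀ ≤ a₁ →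
        ∀ U' : Fin (d + 1) → ScX' d L i.mv i.kk i.r hL → (Matrix mm mm ℂ)ˣ, (pcInstance d mm ι c₄r β₀ hL i).Bf.Reg335 c35 α₀ U' → ∀ n : Fin 4, (n = 1 ∨ n = 2) →
          HasMaj (BlockNorm.ofBlocks (pcGeo d hL i) (liftBlk (scBlk d L i.mv i.kk hL) ι))
            (BlockNorm.ofBlocks (pcGeo d hL i) (liftBlk (scBlk d L i.mv i.kk hL ∘ kingPr L i.kk i.r (cvM d L i.mv i.kk hL)) ι)) (E i n U')
            (fun y y' => B₁ * B9.pref4 ((opGeo (pcGeo d hL i) (ScX d L i.mv i.kk hL × ι) (liftBlk (scBlk d L i.mv i.kk hL) ι)).len y) n * Real.exp (-(δ₁ * (pcGeo d hL i).dist y y')) *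
              max (rateFactor (opGeo (pcGeo d hL i) (ScX d L i.mv i.kk hL × ι) (liftBlk (scBlk d L i.mv i.kk hL) ι)) γ₁ y)
                (rateFactor (opGeo (pcGeo d hL i) (ScX d L i.mv i.kk hL × ι) (liftBlk (scBlk d L i.mv i.kk hL) ι)) γ₁ y'))) :
    NE2PlusOperator c35 (pcInstance d mm ι c₄r β₀ hL) (fun i => pcFamily d mm ι a₀ e c₄r β₀ hL i (E i)) := by
  obtain ⟨δ, w₀, c₀, D, hδ, hc₀, hD, H0⟩ := uN_idef_scGreenOp_of_reg910_rate (d := d) hL hL7 ha₀ ι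
  obtain ⟨δ₃, w₃, c₃, D₃, ρ₀, hδ₃, hc₃, hρ₀, hD₃, H3⟩ := uN_idef_scGreenOp_entryThree_of_reg910_rate (d := d) hL hL7 ha₀ ι
  obtain ⟨M₁, δ₁, a₁, B₁, γ₁, hM₁, hδ₁, ha₁, hB₁, hγ₁, hE⟩ := hE
  have hLpos : 0 < L := Nat.pos_of_ne_zero (NeZero.ne L)
  have hLr : (0 : ℝ) < (L : ℝ) := Nat.cast_pos.mpr hLpos
  have hL1 : (1 : ℝ) ≤ (L : ℝ) := by exact_mod_cast hLpos
  -- the constants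
  have hκ0 : 0 ≤ @basisConst ι _ (Matrix mm mm ℂ) Matrix.frobeniusNormedAddCommGroup Matrix.frobeniusNormedSpace e :=
    @basisConst_nonneg ι _ (Matrix mm mm ℂ) Matrix.frobeniusNormedAddCommGroup Matrix.frobeniusNormedSpace e
  obtain ⟨S, hS⟩ : ∃ S : ℝ, S = (1 + @basisConst ι _ (Matrix mm mm ℂ) Matrix.frobeniusNormedAddCommGroup Matrix.frobeniusNormedSpace e * (2 * Real.sqrt (Fintype.card mm)) * Real.sqrt (Fintype.card mm)) ^ 2 := ⟨_, rfl⟩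
  have hS0 : 0 ≤ S := by rw [hS]; positivity
  obtain ⟨a₀', ha₀'⟩ : ∃ a₀' : ℝ, a₀' = min a₁ (min c₀ c₃ / (2 * c35 * S + 1)) := ⟨_, rfl⟩
  have ha₀'pos : 0 < a₀' := by rw [ha₀']; exact lt_min ha₁ (div_pos (lt_min hc₀ hc₃) (by positivity))
  have ha₀'a₁ : a₀' ≤ a₁ := by rw [ha₀']; exact min_le_left _ _
  have ha₀'c : 2 * c35 * S * a₀' ≤ min c₀ c₃ := by
    have h2 : a₀' ≤ min c₀ c₃ / (2 * c35 * S + 1) := by rw [ha₀']; exact min_le_right _ _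
    have hden : 0 < 2 * c35 * S + 1 := by positivity
    have hmc : 0 ≤ min c₀ c₃ := (lt_min hc₀ hc₃).le
    calc 2 * c35 * S * a₀' ≤ 2 * c35 * S * (min c₀ c₃ / (2 * c35 * S + 1)) := mul_le_mul_of_nonneg_left h2 (by positivity)
      _ = min c₀ c₃ * (2 * c35 * S) / (2 * c35 * S + 1) := by ring
      _ ≤ min c₀ c₃ * (2 * c35 * S + 1) / (2 * c35 * S + 1) := by gcongr; linarith
      _ = min c₀ c₃ := by field_simp
  -- the largest class constant and the constant of 392∕396 there
  obtain ⟨Cm, hCm⟩ : ∃ Cm : ℝ, Cm = c35 * a₀' := ⟨_, rfl⟩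
  have hCm0 : 0 ≤ Cm := by rw [hCm]; positivity
  obtain ⟨Rm, hRm⟩ : ∃ Rm : ℝ, Rm = (4 * (c₄r * Cm) * ((1 : ℝ) ^ (2 + β₀))⁻¹ * Real.exp (5 * (Cm / 1))) + ((2 * ((d + 1 : ℕ) : ℝ) + 2) * ((Cm / 1 ^ 2) ^ 2 * Real.exp (2 * (Cm / 1))) +
      8 * ((Cm / 1) * (Cm / 1 ^ 2) * Real.exp (2 * (Cm / 1))) + 8 * ((Cm / 1) * (Cm / 1 ^ 2) * Real.exp (5 * (Cm / 1)))) := ⟨_, rfl⟩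
  have hRm0 : 0 ≤ Rm := by
    have : (0 : ℝ) < ((1 : ℝ) ^ (2 + β₀))⁻¹ := by rw [Real.one_rpow, inv_one]; exact one_pos
    rw [hRm]; positivity
  obtain ⟨K, hK⟩ : ∃ K : ℝ, K = (1 + @basisConst ι _ (Matrix mm mm ℂ) Matrix.frobeniusNormedAddCommGroup Matrix.frobeniusNormedSpace e * Fintype.card mm * Rm) * (1 + (2 : ℝ) ^ β₀) := ⟨_, rfl⟩
  have hK0 : 0 ≤ K := by rw [hK]; positivity
  let M₅ : ℝ := max (max w₀ w₃) (max M₁ 1)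
  have hM₅ : 0 < M₅ := lt_of_lt_of_le one_pos ((le_max_right _ _).trans (le_max_right _ _))
  let δ₀ : ℝ := min (min (δ / 16) ρ₀) δ₁
  have hδ₀ : 0 < δ₀ := lt_min (lt_min (by positivity) hρ₀) hδ₁
  let γ : ℝ := min (min (1 / 4 : ℝ) β₀) γ₁
  have hγ : 0 < γ := lt_min (lt_min (by norm_num) hβ₀) hγ₁
  let B₀ : ℝ := (max D 0 + max D₃ 0) * K + B₁
  have hB₀ : 0 < B₀ := add_pos_of_nonneg_of_pos (by positivity) hB₁
  refine ⟨M₅, δ₀, a₀', B₀, γ, hM₅, hδ₀, ha₀'pos, hB₀, hγ, fun i hM α₀ hα₀ hMa U' hU' => ?_⟩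
  -- the guard `M₅ ≤ gf.M = L^m` and the class at the index
  have hM' : M₅ ≤ (L : ℝ) ^ i.mv := hM
  have hw₀ : w₀ ≤ ((L ^ i.mv : ℕ) : ℝ) := by push_cast; exact ((le_max_left _ _).trans (le_max_left _ _)).trans hM'
  have hw₃ : w₃ ≤ ((L ^ i.mv : ℕ) : ℝ) := by push_cast; exact ((le_max_right _ _).trans (le_max_left _ _)).trans hM'
  have hM₁' : M₁ ≤ (L : ℝ) ^ i.mv := ((le_max_left _ _).trans (le_max_right _ _)).trans hM'
  have hMa₁ : (L : ℝ) ^ i.mv * α₀ ≤ a₁ := hMa.trans ha₀'a₁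
  obtain ⟨hU'g, h910⟩ := (pcInstance_reg335_iff d mm ι c₄r β₀ hL i c35 α₀ U').1 hU'
  have hC0 : 0 ≤ c35 * (L : ℝ) ^ i.mv * α₀ := by positivity
  have hCle : c35 * (L : ℝ) ^ i.mv * α₀ ≤ Cm := by
    rw [hCm, mul_assoc]; exact mul_le_mul_of_nonneg_left hMa hc35.le
  have hC₄0 : 0 ≤ c₄r * (c35 * (L : ℝ) ^ i.mv * α₀) := mul_nonneg hc₄r hC0
  -- BOTH smallness conditions at `ξ = 1`
  have hsm : (1 + @basisConst ι _ (Matrix mm mm ℂ) Matrix.frobeniusNormedAddCommGroup Matrix.frobeniusNormedSpace e * (2 * Real.sqrt (Fintype.card mm)) * Real.sqrt (Fintype.card mm)) ^ 2 *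
      (c35 * (L : ℝ) ^ i.mv * α₀ / 1 + c35 * (L : ℝ) ^ i.mv * α₀ / 1 ^ 2) ≤ min c₀ c₃ := by
    rw [← hS, div_one, one_pow, div_one]
    calc S * (c35 * (L : ℝ) ^ i.mv * α₀ + c35 * (L : ℝ) ^ i.mv * α₀) ≤ S * (Cm + Cm) := by gcongr
      _ = 2 * c35 * S * a₀' := by rw [hCm]; ring
      _ ≤ min c₀ c₃ := ha₀'c
  have hsm0 := hsm.trans (min_le_left c₀ c₃)
  have hsm3 := hsm.trans (min_le_right c₀ c₃)
  have hη0 : (0 : ℝ) ≤ (pcGeo d hL i).eta := by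
    show (0 : ℝ) ≤ ((L : ℝ) ^ i.kk)⁻¹
    positivity
  -- the scalar facts at the index
  have hx1 : (1 : ℝ) ≤ (L : ℝ) ^ i.kk := one_le_pow₀ hL1
  have hxpos : (0 : ℝ) < (L : ℝ) ^ i.kk := pow_pos hLr _
  have hrf : ∀ y : (pcGeo d hL i).Site, ∀ γ' : ℝ, rateFactor (opGeo (pcGeo d hL i) (ScX d L i.mv i.kk hL × ι) (liftBlk (scBlk d L i.mv i.kk hL) ι)) γ' y = ((L : ℝ) ^ i.kk) ^ (-γ') :=
    fun y γ' => sfGeo_rateFactor d hL i.toSf _ γ' y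
  have hγ4 : γ ≤ 1 / 4 := (min_le_left _ _).trans (min_le_left _ _)
  have hγβ : γ ≤ β₀ := (min_le_left _ _).trans (min_le_right _ _)
  have hγ₁' : γ ≤ γ₁ := min_le_right _ _
  have hrfγ₁ : ((L : ℝ) ^ i.kk) ^ (-γ₁) ≤ ((L : ℝ) ^ i.kk) ^ (-γ) := Real.rpow_le_rpow_of_exponent_le hx1 (by linarith)
  have hrpos : 0 ≤ ((L : ℝ) ^ i.kk) ^ (-γ) := Real.rpow_nonneg hxpos.le _
  -- `(L^k)^{−1∕4} + (2L^{−k})^{β₀} ≤ (1 + 2^{β₀})(L^k)^{−γ}`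
  have hηeq : ((((L ^ i.kk : ℕ) : ℝ))⁻¹) = ((L : ℝ) ^ i.kk)⁻¹ := by rw [Nat.cast_pow]
  have hsum : ((L : ℝ) ^ i.kk) ^ (-(1 / 4 : ℝ)) + (2 * ((((L ^ i.kk : ℕ) : ℝ))⁻¹)) ^ β₀ ≤ (1 + (2 : ℝ) ^ β₀) * ((L : ℝ) ^ i.kk) ^ (-γ) := by
    have h14 : ((L : ℝ) ^ i.kk) ^ (-(1 / 4 : ℝ)) ≤ ((L : ℝ) ^ i.kk) ^ (-γ) := Real.rpow_le_rpow_of_exponent_le hx1 (by linarith)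
    have hβ' : (2 * ((((L ^ i.kk : ℕ) : ℝ))⁻¹)) ^ β₀ ≤ (2 : ℝ) ^ β₀ * ((L : ℝ) ^ i.kk) ^ (-γ) := by
      rw [hηeq, Real.mul_rpow (by norm_num) (inv_nonneg.mpr hxpos.le), Real.inv_rpow hxpos.le, ← Real.rpow_neg hxpos.le]
      exact mul_le_mul_of_nonneg_left (Real.rpow_le_rpow_of_exponent_le hx1 (by linarith)) (Real.rpow_nonneg (by norm_num) _)
    have := add_le_add h14 hβ'; linarith
  have hsum0 : 0 ≤ ((L : ℝ) ^ i.kk) ^ (-(1 / 4 : ℝ)) + (2 * ((((L ^ i.kk : ℕ) : ℝ))⁻¹)) ^ β₀ := by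
    have : 0 ≤ (2 * ((((L ^ i.kk : ℕ) : ℝ))⁻¹)) ^ β₀ := Real.rpow_nonneg (by rw [hηeq]; positivity) _
    have : 0 ≤ ((L : ℝ) ^ i.kk) ^ (-(1 / 4 : ℝ)) := Real.rpow_nonneg hxpos.le _
    linarith
  -- the constant of 392∕396 at the class constant is below `Rm`
  have hRle : (4 * (c₄r * (c35 * (L : ℝ) ^ i.mv * α₀)) * ((1 : ℝ) ^ (2 + β₀))⁻¹ * Real.exp (5 * (c35 * (L : ℝ) ^ i.mv * α₀ / 1))) +
      ((2 * ((d + 1 : ℕ) : ℝ) + 2) * ((c35 * (L : ℝ) ^ i.mv * α₀ / 1 ^ 2) ^ 2 * Real.exp (2 * (c35 * (L : ℝ) ^ i.mv * α₀ / 1))) +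
        8 * ((c35 * (L : ℝ) ^ i.mv * α₀ / 1) * (c35 * (L : ℝ) ^ i.mv * α₀ / 1 ^ 2) * Real.exp (2 * (c35 * (L : ℝ) ^ i.mv * α₀ / 1))) +
        8 * ((c35 * (L : ℝ) ^ i.mv * α₀ / 1) * (c35 * (L : ℝ) ^ i.mv * α₀ / 1 ^ 2) * Real.exp (5 * (c35 * (L : ℝ) ^ i.mv * α₀ / 1)))) ≤ Rm := by
    rw [hRm]; exact pcRateConst_mono (Nat.cast_nonneg _) hc₄r hC0 hCle
  have hKle : (1 + @basisConst ι _ (Matrix mm mm ℂ) Matrix.frobeniusNormedAddCommGroup Matrix.frobeniusNormedSpace e * Fintype.card mm *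
      ((4 * (c₄r * (c35 * (L : ℝ) ^ i.mv * α₀)) * ((1 : ℝ) ^ (2 + β₀))⁻¹ * Real.exp (5 * (c35 * (L : ℝ) ^ i.mv * α₀ / 1))) +
      ((2 * ((d + 1 : ℕ) : ℝ) + 2) * ((c35 * (L : ℝ) ^ i.mv * α₀ / 1 ^ 2) ^ 2 * Real.exp (2 * (c35 * (L : ℝ) ^ i.mv * α₀ / 1))) +
        8 * ((c35 * (L : ℝ) ^ i.mv * α₀ / 1) * (c35 * (L : ℝ) ^ i.mv * α₀ / 1 ^ 2) * Real.exp (2 * (c35 * (L : ℝ) ^ i.mv * α₀ / 1))) +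
        8 * ((c35 * (L : ℝ) ^ i.mv * α₀ / 1) * (c35 * (L : ℝ) ^ i.mv * α₀ / 1 ^ 2) * Real.exp (5 * (c35 * (L : ℝ) ^ i.mv * α₀ / 1)))))) *
      (((L : ℝ) ^ i.kk) ^ (-(1 / 4 : ℝ)) + (2 * ((((L ^ i.kk : ℕ) : ℝ))⁻¹)) ^ β₀) ≤ K * ((L : ℝ) ^ i.kk) ^ (-γ) := by
    rw [hK, mul_assoc (1 + _ * _ * Rm)]
    refine mul_le_mul ?_ hsum hsum0 (by positivity)
    have := mul_le_mul_of_nonneg_left hRle (mul_nonneg hκ0 (Nat.cast_nonneg (Fintype.card mm)))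
    linarith
  have hd0 : ∀ y y' : (pcGeo d hL i).Site, 0 ≤ (pcGeo d hL i).dist y y' := fun y y' => sfGeo_dist_nonneg d hL i.toSf y y'
  have hδ₀le : δ₀ ≤ δ / 16 := (min_le_left _ _).trans (min_le_left _ _)
  have hδ₀le₃ : δ₀ ≤ ρ₀ := (min_le_left _ _).trans (min_le_right _ _)
  have hδ₀le₁ : δ₀ ≤ δ₁ := min_le_right _ _
  have hBD : max D 0 * K ≤ B₀ := by
    show max D 0 * K ≤ (max D 0 + max D₃ 0) * K + B₁
    nlinarith [le_max_right D 0, le_max_right D₃ 0, hK0, hB₁.le]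
  have hBD₃ : max D₃ 0 * K ≤ B₀ := by
    show max D₃ 0 * K ≤ (max D 0 + max D₃ 0) * K + B₁
    nlinarith [le_max_right D 0, le_max_right D₃ 0, hK0, hB₁.le]
  have hBB : B₁ ≤ B₀ := by
    show B₁ ≤ (max D 0 + max D₃ 0) * K + B₁
    have : 0 ≤ (max D 0 + max D₃ 0) * K := by positivity
    linarith
  refine etaRateIneq342_of_hasMaj (liftBlk (scBlk d L i.mv i.kk hL) ι) (liftBlk (scBlk d L i.mv i.kk hL ∘ kingPr L i.kk i.r (cvM d L i.mv i.kk hL)) ι) hη0 hLr.le hB₀.le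
    (pcOps d mm ι a₀ e hL i (E i)) U' fun n => ?_
  -- the common scalar step: `Dx·(1 + κ m R(C))·rate·e^{−t·d} ≤ B₀·pref4·e^{−δ₀d}·max rf` for `t ≥ δ₀`, `max Dx 0·K ≤ B₀`
  have step : ∀ (Dx t : ℝ) (n : Fin 4) (y y' : (pcGeo d hL i).Site), δ₀ ≤ t → max Dx 0 * K ≤ B₀ →
      Dx * (1 + @basisConst ι _ (Matrix mm mm ℂ) Matrix.frobeniusNormedAddCommGroup Matrix.frobeniusNormedSpace e * Fintype.card mm *
        ((4 * (c₄r * (c35 * (L : ℝ) ^ i.mv * α₀)) * ((1 : ℝ) ^ (2 + β₀))⁻¹ * Real.exp (5 * (c35 * (L : ℝ) ^ i.mv * α₀ / 1))) +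
        ((2 * ((d + 1 : ℕ) : ℝ) + 2) * ((c35 * (L : ℝ) ^ i.mv * α₀ / 1 ^ 2) ^ 2 * Real.exp (2 * (c35 * (L : ℝ) ^ i.mv * α₀ / 1))) +
          8 * ((c35 * (L : ℝ) ^ i.mv * α₀ / 1) * (c35 * (L : ℝ) ^ i.mv * α₀ / 1 ^ 2) * Real.exp (2 * (c35 * (L : ℝ) ^ i.mv * α₀ / 1))) +
          8 * ((c35 * (L : ℝ) ^ i.mv * α₀ / 1) * (c35 * (L : ℝ) ^ i.mv * α₀ / 1 ^ 2) * Real.exp (5 * (c35 * (L : ℝ) ^ i.mv * α₀ / 1)))))) *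
        (((L : ℝ) ^ i.kk) ^ (-(1 / 4 : ℝ)) + (2 * ((((L ^ i.kk : ℕ) : ℝ))⁻¹)) ^ β₀) * Real.exp (-(t * (unitTorusGeo L i.kk (cvM d L i.mv i.kk hL)).dist y y')) ≤
      B₀ * B9.pref4 ((opGeo (pcGeo d hL i) (ScX d L i.mv i.kk hL × ι) (liftBlk (scBlk d L i.mv i.kk hL) ι)).len y) n * Real.exp (-(δ₀ * (pcGeo d hL i).dist y y')) *
        max (rateFactor (opGeo (pcGeo d hL i) (ScX d L i.mv i.kk hL × ι) (liftBlk (scBlk d L i.mv i.kk hL) ι)) γ y)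
          (rateFactor (opGeo (pcGeo d hL i) (ScX d L i.mv i.kk hL × ι) (liftBlk (scBlk d L i.mv i.kk hL) ι)) γ y') := by
    intro Dx t n y y' ht hDK
    rw [opGeo_len, sfGeo_len d hL i.toSf y, hrf y γ, hrf y' γ, max_self]
    have hpref : (1 : ℝ) ≤ B9.pref4 (1 : ℝ) n := by fin_cases n <;> simp [B9.pref4]
    have hexp : Real.exp (-(t * (unitTorusGeo L i.kk (cvM d L i.mv i.kk hL)).dist y y')) ≤ Real.exp (-(δ₀ * (pcGeo d hL i).dist y y')) := by
      refine Real.exp_le_exp.mpr (neg_le_neg ?_)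
      exact mul_le_mul_of_nonneg_right ht (hd0 y y')
    have hE0 : 0 ≤ Real.exp (-(t * (unitTorusGeo L i.kk (cvM d L i.mv i.kk hL)).dist y y')) := Real.exp_nonneg _
    have hmid0 : 0 ≤ (1 + @basisConst ι _ (Matrix mm mm ℂ) Matrix.frobeniusNormedAddCommGroup Matrix.frobeniusNormedSpace e * Fintype.card mm *
        ((4 * (c₄r * (c35 * (L : ℝ) ^ i.mv * α₀)) * ((1 : ℝ) ^ (2 + β₀))⁻¹ * Real.exp (5 * (c35 * (L : ℝ) ^ i.mv * α₀ / 1))) +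
        ((2 * ((d + 1 : ℕ) : ℝ) + 2) * ((c35 * (L : ℝ) ^ i.mv * α₀ / 1 ^ 2) ^ 2 * Real.exp (2 * (c35 * (L : ℝ) ^ i.mv * α₀ / 1))) +
          8 * ((c35 * (L : ℝ) ^ i.mv * α₀ / 1) * (c35 * (L : ℝ) ^ i.mv * α₀ / 1 ^ 2) * Real.exp (2 * (c35 * (L : ℝ) ^ i.mv * α₀ / 1))) +
          8 * ((c35 * (L : ℝ) ^ i.mv * α₀ / 1) * (c35 * (L : ℝ) ^ i.mv * α₀ / 1 ^ 2) * Real.exp (5 * (c35 * (L : ℝ) ^ i.mv * α₀ / 1)))))) *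
        (((L : ℝ) ^ i.kk) ^ (-(1 / 4 : ℝ)) + (2 * ((((L ^ i.kk : ℕ) : ℝ))⁻¹)) ^ β₀) := by
      have : (0 : ℝ) < ((1 : ℝ) ^ (2 + β₀))⁻¹ := by rw [Real.one_rpow, inv_one]; exact one_pos
      positivity
    calc Dx * (1 + @basisConst ι _ (Matrix mm mm ℂ) Matrix.frobeniusNormedAddCommGroup Matrix.frobeniusNormedSpace e * Fintype.card mm *
            ((4 * (c₄r * (c35 * (L : ℝ) ^ i.mv * α₀)) * ((1 : ℝ) ^ (2 + β₀))⁻¹ * Real.exp (5 * (c35 * (L : ℝ) ^ i.mv * α₀ / 1))) +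
            ((2 * ((d + 1 : ℕ) : ℝ) + 2) * ((c35 * (L : ℝ) ^ i.mv * α₀ / 1 ^ 2) ^ 2 * Real.exp (2 * (c35 * (L : ℝ) ^ i.mv * α₀ / 1))) +
              8 * ((c35 * (L : ℝ) ^ i.mv * α₀ / 1) * (c35 * (L : ℝ) ^ i.mv * α₀ / 1 ^ 2) * Real.exp (2 * (c35 * (L : ℝ) ^ i.mv * α₀ / 1))) +
              8 * ((c35 * (L : ℝ) ^ i.mv * α₀ / 1) * (c35 * (L : ℝ) ^ i.mv * α₀ / 1 ^ 2) * Real.exp (5 * (c35 * (L : ℝ) ^ i.mv * α₀ / 1)))))) *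
            (((L : ℝ) ^ i.kk) ^ (-(1 / 4 : ℝ)) + (2 * ((((L ^ i.kk : ℕ) : ℝ))⁻¹)) ^ β₀) * Real.exp (-(t * (unitTorusGeo L i.kk (cvM d L i.mv i.kk hL)).dist y y'))
        ≤ max Dx 0 * (K * ((L : ℝ) ^ i.kk) ^ (-γ)) * Real.exp (-(t * (unitTorusGeo L i.kk (cvM d L i.mv i.kk hL)).dist y y')) := by
          refine mul_le_mul_of_nonneg_right ?_ hE0
          rw [mul_assoc Dx]
          exact (mul_le_mul_of_nonneg_right (le_max_left Dx 0) hmid0).trans (mul_le_mul_of_nonneg_left hKle (le_max_right _ _))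
      _ ≤ max Dx 0 * (K * ((L : ℝ) ^ i.kk) ^ (-γ)) * Real.exp (-(δ₀ * (pcGeo d hL i).dist y y')) := mul_le_mul_of_nonneg_left hexp (by positivity)
      _ = (max Dx 0 * K) * 1 * Real.exp (-(δ₀ * (pcGeo d hL i).dist y y')) * ((L : ℝ) ^ i.kk) ^ (-γ) := by ring
      _ ≤ B₀ * B9.pref4 (1 : ℝ) n * Real.exp (-(δ₀ * (pcGeo d hL i).dist y y')) * ((L : ℝ) ^ i.kk) ^ (-γ) := by
          refine mul_le_mul_of_nonneg_right (mul_le_mul_of_nonneg_right ?_ (Real.exp_nonneg _)) hrpos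
          exact mul_le_mul hDK hpref zero_le_one hB₀.le
  by_cases h0 : n = 0
  · -- ENTRY 0: n15-c∕392 for THE named Green's functions
    subst h0
    rw [pcOps_zero]
    have key := hasMaj_unitTorusGeoS (d := d) (L := L) ((L : ℝ) ^ i.mv)
      (H0 i.mv i.kk i.r i.one_le_kk i.one_le_r hw₀ e he U' hU'g
        (fun k => {z : ScX' d L i.mv i.kk i.r hL | ∃ y ∈ cvSk d L i.mv i.kk hL k, (unitTorusGeo L i.kk (cvM d L i.mv i.kk hL)).dist (scBlk' d L i.mv i.kk i.r hL z) y ≤ 5})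
        1 (c35 * (L : ℝ) ^ i.mv * α₀) β₀ (c₄r * (c35 * (L : ℝ) ^ i.mv * α₀)) one_pos hC0 hβ₀.le hC₄0 hsm0 h910 (fun k z hz => hz))
    unfold pcEntry0
    exact key.mono fun y y' => step D (δ / 16) 0 y y' hδ₀le hBD
  by_cases h3 : n = 3
  · -- ENTRY 3: n15-c∕396 for THE named Green's functions
    subst h3
    rw [pcOps_three]
    have key := hasMaj_unitTorusGeoS (d := d) (L := L) ((L : ℝ) ^ i.mv)
      (H3 i.mv i.kk i.r i.one_le_kk i.one_le_r hw₃ e he U' hU'g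
        (fun k => {z : ScX' d L i.mv i.kk i.r hL | ∃ y ∈ cvSk d L i.mv i.kk hL k, (unitTorusGeo L i.kk (cvM d L i.mv i.kk hL)).dist (scBlk' d L i.mv i.kk i.r hL z) y ≤ 5})
        1 (c35 * (L : ℝ) ^ i.mv * α₀) β₀ (c₄r * (c35 * (L : ℝ) ^ i.mv * α₀)) one_pos hC0 hβ₀.le hC₄0 hsm3 h910 (fun k z hz => hz))
    unfold pcEntry3
    exact key.mono fun y y' => step D₃ ρ₀ 3 y y' hδ₀le₃ hBD₃
  -- ENTRIES 1–2: the displayed rows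
  have h12 : n = 1 ∨ n = 2 := by
    rcases n with ⟨_ | _ | _ | _ | k, hk⟩
    · exact absurd rfl h0
    · exact Or.inl rfl
    · exact Or.inr rfl
    · exact absurd rfl h3
    · omega
  have hop : pcOps d mm ι a₀ e hL i (E i) n U' = E i n U' := by rcases h12 with rfl | rfl <;> rfl
  rw [hop]
  refine (hE i hM₁' α₀ hα₀ hMa₁ U' hU' n h12).mono fun y y' => ?_
  rw [opGeo_len, sfGeo_len d hL i.toSf y, hrf y γ, hrf y' γ, hrf y γ₁, hrf y' γ₁, max_self, max_self]
  have hp0 : 0 ≤ B9.pref4 (1 : ℝ) n := (pref4_pos one_pos n).le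
  have hexp : Real.exp (-(δ₁ * (pcGeo d hL i).dist y y')) ≤ Real.exp (-(δ₀ * (pcGeo d hL i).dist y y')) :=
    Real.exp_le_exp.mpr (neg_le_neg (mul_le_mul_of_nonneg_right hδ₀le₁ (hd0 y y')))
  exact mul_le_mul (mul_le_mul (mul_le_mul_of_nonneg_right hBB hp0) hexp (Real.exp_nonneg _) (by positivity)) hrfγ₁ (Real.rpow_nonneg hxpos.le _) (by positivity)

/-! ## §3 Non-vacuity of the class and NE2⁰ by name -/

omit [Nonempty mm] [DecidableEq ι] in
/-- **THE CLASS IS INHABITED AT EVERY INDEX**: the trivial configuration `U′ ≡ 1` is (3.35)-regular for all `c, α₀ > 0` (`c₄r > 0`) — unitary, and dag-n07-a's `reg910Cube_one`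
(«the configuration identically equal to 1 satisfies all regularity conditions», [B8] p.98) on every cube. [cite: Balaban1985Variational, (9)–(10) p.279; Balaban1985RegularSpaces, p.98] -/
theorem pcInstance_reg335_one [Nonempty mm] (hL : Odd L ∧ 1 < L) {c₄r β₀ : ℝ} (hc₄r : 0 < c₄r) (i : PcIdx d L) {c α₀ : ℝ} (hc : 0 < c) (hα₀ : 0 < α₀) :
    (pcInstance d mm ι c₄r β₀ hL i).Bf.Reg335 c α₀ (pcInstance d mm ι c₄r β₀ hL i).Bf.one := by
  have hLr : (0 : ℝ) < (L : ℝ) := Nat.cast_pos.mpr (Nat.pos_of_ne_zero (NeZero.ne L))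
  have hC : 0 < c * (L : ℝ) ^ i.mv * α₀ := by positivity
  refine (pcInstance_reg335_iff d mm ι c₄r β₀ hL i c α₀ _).2 ⟨fun μ x' => ?_, fun k => ?_⟩
  · show ((1 : (Matrix mm mm ℂ)ˣ) : Matrix mm mm ℂ) ∈ Matrix.unitaryGroup mm ℂ
    rw [Units.val_one]
    exact Submonoid.one_mem _
  · exact B11Reg910Classes.reg910Cube_one _ _ _ one_pos _ hC (mul_pos hc₄r hC) β₀

/-- ★★★ **NE2⁰, OPERATOR LAYER, BY NAME** for the named family — `T4EtaRate.ne2Zero_of_ne2Plus` on `ne2PlusOperator_pc₀₃` and the inhabited class: the η-difference inequalities at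
the TRIVIAL background (King's `A = 0` layer) for THE flat-transporter Green's functions, read off the live-background theorem. [cite: King1986, Props. 3.8–3.9 (3.71)–(3.75) pp.664–665 (A = 0 model); Balaban1985BackgroundPropagators, Thm 3.1 p.397 (template)] -/
theorem ne2ZeroOperator_pc₀₃ (hL : Odd L ∧ 1 < L) (hL7 : 7 ≤ L) {a₀ : ℝ} (ha₀ : 0 < a₀) {c35 : ℝ} (hc35 : 0 < c35) {c₄r : ℝ} (hc₄r : 0 < c₄r) {β₀ : ℝ} (hβ₀ : 0 < β₀)
    (he : ∀ A B : Matrix mm mm ℂ, traceForm A B = e A ⬝ᵥ e B)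
    (E : ∀ i : PcIdx d L, Fin 4 → (Fin (d + 1) → ScX' d L i.mv i.kk i.r hL → (Matrix mm mm ℂ)ˣ) → ((ScX d L i.mv i.kk hL × ι → ℝ) →ₗ[ℝ] (ScX' d L i.mv i.kk i.r hL × ι → ℝ)))
    (hE : ∃ M₁ δ₁ a₁ B₁ γ₁ : ℝ, 0 < M₁ ∧ 0 < δ₁ ∧ 0 < a₁ ∧ 0 < B₁ ∧ 0 < γ₁ ∧
      ∀ i : PcIdx d L, M₁ ≤ (L : ℝ) ^ i.mv → ∀ α₀ : ℝ, 0 < α₀ → (L : ℝ) ^ i.mv * α₀ ≤ a₁ →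
        ∀ U' : Fin (d + 1) → ScX' d L i.mv i.kk i.r hL → (Matrix mm mm ℂ)ˣ, (pcInstance d mm ι c₄r β₀ hL i).Bf.Reg335 c35 α₀ U' → ∀ n : Fin 4, (n = 1 ∨ n = 2) →
          HasMaj (BlockNorm.ofBlocks (pcGeo d hL i) (liftBlk (scBlk d L i.mv i.kk hL) ι))
            (BlockNorm.ofBlocks (pcGeo d hL i) (liftBlk (scBlk d L i.mv i.kk hL ∘ kingPr L i.kk i.r (cvM d L i.mv i.kk hL)) ι)) (E i n U')
            (fun y y' => B₁ * B9.pref4 ((opGeo (pcGeo d hL i) (ScX d L i.mv i.kk hL × ι) (liftBlk (scBlk d L i.mv i.kk hL) ι)).len y) n * Real.exp (-(δ₁ * (pcGeo d hL i).dist y y')) *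
              max (rateFactor (opGeo (pcGeo d hL i) (ScX d L i.mv i.kk hL × ι) (liftBlk (scBlk d L i.mv i.kk hL) ι)) γ₁ y)
                (rateFactor (opGeo (pcGeo d hL i) (ScX d L i.mv i.kk hL × ι) (liftBlk (scBlk d L i.mv i.kk hL) ι)) γ₁ y'))) :
    T4EtaRate.NE2ZeroOperator (pcInstance d mm ι c₄r β₀ hL) (fun i => pcFamily d mm ι a₀ e c₄r β₀ hL i (E i)) :=
  T4EtaRate.ne2Zero_of_ne2Plus (fun i _ hα₀ => pcInstance_reg335_one d mm ι hL hc₄r i hc35 hα₀) (ne2PlusOperator_pc₀₃ d mm ι e hL hL7 ha₀ hc35 hc₄r.le hβ₀ he E hE)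

end Node

end Summit.QuantumFields.YangMills.BalabanUVNodes.N15.Gluing

end
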